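import Summits.ABC.ABC.Theses.CubicResolventAllowance
import Literature.Barriers.ABC.SzpiroEpsilonCannotBeDroppedProofs
import HarnessLib

/-!
# stub-ideation k2 (RESHAPE) — generation 9 sketch for `stub_complexCubic` (crux `IndexSzpiro`, stmt-ABC-22740)

Companion to `STUB-IDEAS-stub_complexCubic-2.md` (gen 9).  Gens 7/8 (`StubIdeas2G7Sketch.lean`,
`StubIdeas2G8Sketch.lean`, same directory) are carried BY REFERENCE.  This file only TYPES what gen 9 adds:

* §A  the split of gen-8's only open orbit input `Z0_orbit` into template-sized pieces
  (`A1`–`A6`; the 3-adic part `A4/A5` is the one step NOT covered by the tree template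
  `Literature.Barriers.ABC.BennettYazdani.orbit`, because here `ord₃ X_j = +2`, a unit recursion, not a pole);
* §B  the two quantifier / allowance reshapes of the stub, typed so that their (trivial) relations to the stub
  and to polynomial Szpiro on the class are checkable statements (`B1`–`B3`).

Bodies are `sorry` unless one line; statements are what is being sanity-checked here.
-/

open Polynomial

set_option linter.dupNamespace false

namespace Summit.ABC.ABC.Cruxes.IndexSzpiro.StubIdeas2G9

open Summit.ABC.ABC.Theses.CubicResolventAllowance (IndexSzpiro)

/-! ## §0  The stub (verbatim) and the gen-7/8 orbit (copied: 3 one-line defs) -/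

/-- `stub_complexCubic`, verbatim. -/
def Stub : Prop :=
  ∀ ε : ℝ, 0 < ε → ∃ C : ℝ, ∀ (W : WeierstrassCurve ℚ) [W.IsElliptic] (K : Type) [Field K] [NumberField K],
    Irreducible W.twoTorsionPolynomial.toPoly → Module.finrank ℚ K = 3 →
    (∃ θ : K, aeval θ W.twoTorsionPolynomial.toPoly = 0) → NumberField.discr K < 0 →
    (W.minimalDiscriminantNorm ℤ : ℝ) ≤ C * |(NumberField.discr K : ℝ)| * (W.conductorNorm ℤ : ℝ) ^ (6 + ε)

/-- `x`-coordinate duplication on `E₀ : Y² = X³ + 5832` (`5832 = 18³`; gen 7/8 verbatim). -/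
def dbl (X : ℚ) : ℚ := (X ^ 4 - 46656 * X) / (4 * (X ^ 3 + 5832))

/-- The orbit `X_j = x(2^j Q₀)`, `Q₀ = (−63/4, 351/8)` (gen 7/8 verbatim). -/
def Xorb (j : ℕ) : ℚ := dbl^[j] (-63 / 4)

theorem Xorb_zero : Xorb 0 = -63 / 4 := rfl

theorem Xorb_succ (j : ℕ) : Xorb (j + 1) = dbl (Xorb j) := by
  rw [Xorb, Function.iterate_succ_apply']; rfl

/-! ## §A  `Z0_orbit` split into template-sized pieces -/

/-- **A1 (S, identity; template `BennettYazdani.dbl_cube_sub` with `b = 5832`):**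
`x(2P)³ + b = (X⁶ + 20b X³ − 8b²)² / (64 (X³ + b)³)`, here `20b = 116640`, `8b² = 272097792`. -/
theorem A1_dbl_cube_add (X : ℚ) (hX : X ^ 3 + 5832 ≠ 0) :
    dbl X ^ 3 + 5832 = (X ^ 6 + 116640 * X ^ 3 - 272097792) ^ 2 / (64 * (X ^ 3 + 5832) ^ 3) := by
  unfold dbl
  field_simp
  ring

/-- **A2 (S; template `BennettYazdani.padicValRat_dbl`):** at a pole of `X` the duplication loses exactly
`ord_p 4`: `dbl X = X (X³ − 46656) / (4 (X³ + 5832))` and both cubes dominate the constants. -/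
theorem A2_padicValRat_dbl {p : ℕ} [Fact p.Prime] {X : ℚ} (hX : padicValRat p X < 0) :
    padicValRat p (dbl X) = padicValRat p X - padicValRat p 4 := by
  sorry

/-- **A3 (S; template `BennettYazdani.orbit` minus its 3-adic clause, `exists_start` ↦ `(−63/4, 351/8)`):**
the points stay on `E₀` and `ord₂ X_j = −2 − 2j` (so `X_j³ + 5832 ≠ 0`, `X_j ≠ 18`, `X_j ≠ −18`). -/
theorem A3_orbit₂ (j : ℕ) :
    (∃ Y : ℚ, Y ^ 2 = Xorb j ^ 3 + 5832) ∧ padicValRat 2 (Xorb j) = -2 - 2 * j := by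
  sorry

/-- **A4 (S/M, the NEW step — 3-adic INTEGRAL FORM is `dbl`-stable):** writing `X = 9 (2 + 3 a/d)` with
`3 ∤ d`, one has `dbl X = 9 (2 + 3 a'/d')` with the explicit
`a' = 27a⁴ − 72a²d² − 128ad³ − 80d⁴`, `d' = 4d (27a³ + 54a²d + 36ad² + 16d³)`, and `3 ∤ d'`
(`27a³ + 54a²d + 36ad² + 16d³ ≡ d³ (mod 3)`; this factor is `((2d+3a)³ + 8d³)`, i.e. `d³ (u³ + 8)`,
hence also `≠ 0` and `X³ + 5832 = 729 (u³+8) ≠ 0`).  Pure `field_simp; ring` + `decide` in `ZMod 3`. -/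
theorem A4_threeAdicForm_step (a d : ℤ) (hd : d ≠ 0) (h3 : ¬ (3 : ℤ) ∣ d) :
    ¬ (3 : ℤ) ∣ 4 * d * (27 * a ^ 3 + 54 * a ^ 2 * d + 36 * a * d ^ 2 + 16 * d ^ 3) ∧
    4 * d * (27 * a ^ 3 + 54 * a ^ 2 * d + 36 * a * d ^ 2 + 16 * d ^ 3) ≠ 0 ∧
    dbl (9 * (2 + 3 * ((a : ℚ) / d))) =
      9 * (2 + 3 * (((27 * a ^ 4 - 72 * a ^ 2 * d ^ 2 - 128 * a * d ^ 3 - 80 * d ^ 4 : ℤ) : ℚ) /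
        ((4 * d * (27 * a ^ 3 + 54 * a ^ 2 * d + 36 * a * d ^ 2 + 16 * d ^ 3) : ℤ) : ℚ))) := by
  sorry

/-- **A5 (S from A4 by induction; start `−63/4 = 9 (2 + 3·(−5)/4)`):** the 3-adic coset invariant
`X_j ∈ 9 · (2 + 3 ℤ₍₃₎)` in denominator language (no `ℤ_[3]`, no valuations of sums needed). -/
theorem A5_threeAdicForm (j : ℕ) :
    ∃ a d : ℤ, d ≠ 0 ∧ ¬ (3 : ℤ) ∣ d ∧ Xorb j = 9 * (2 + 3 * ((a : ℚ) / d)) := by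
  sorry

/-- **A6 (S from A3 + A5): gen-8 `Z0_orbit` verbatim.**  From A5: `X_j = 9 (2d + 3a)/d` with `3 ∤ d (2d+3a)`
gives `ord₃ X_j = 2` (`padicValRat.mul/div/of_int`, `padicValInt.eq_zero_of_not_dvd`); `X_j − 18 = 27 a/d`
with `a ≠ 0` (else `X_j = 18`, contradicting `ord₂ X_j < 0` from A3) gives `ord₃ (X_j − 18) = 3 + ord₃ a ≥ 3`. -/
theorem A6_Z0_orbit (j : ℕ) :
    (∃ Y : ℚ, Y ^ 2 = Xorb j ^ 3 + 5832) ∧ padicValRat 2 (Xorb j) = -2 - 2 * j ∧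
      padicValRat 3 (Xorb j) = 2 ∧ 3 ≤ padicValRat 3 (Xorb j - 18) := by
  sorry

/-- Sanity instance of A4/A5 at `j = 1` (the numbers in the plan): `X₁ = 279657/2704 = 9·(2 + 3·8555/2704)`. -/
example : dbl (-63 / 4) = 279657 / 2704 ∧ (279657 : ℚ) / 2704 = 9 * (2 + 3 * (8555 / 2704)) := by
  constructor
  · norm_num [dbl]
  · norm_num

/-! ## §B  The two quantifier / allowance reshapes, typed -/

/-- **B-dial.** Szpiro-with-resolvent-allowance at a general exponent `A` on the complex class
(`A = 6 + ε` for every `ε > 0` is the stub). -/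
def IndexSzpiroExp (A : ℝ) : Prop :=
  ∃ C : ℝ, ∀ (W : WeierstrassCurve ℚ) [W.IsElliptic] (K : Type) [Field K] [NumberField K],
    Irreducible W.twoTorsionPolynomial.toPoly → Module.finrank ℚ K = 3 →
    (∃ θ : K, aeval θ W.twoTorsionPolynomial.toPoly = 0) → NumberField.discr K < 0 →
    (W.minimalDiscriminantNorm ℤ : ℝ) ≤ C * |(NumberField.discr K : ℝ)| * (W.conductorNorm ℤ : ℝ) ^ A

/-- Polynomial Szpiro with exponent `A` on the complex resolvent class (no allowance). -/
def PolySzpiroOnComplexClass (A : ℝ) : Prop :=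
  ∃ C : ℝ, ∀ (W : WeierstrassCurve ℚ) [W.IsElliptic] (K : Type) [Field K] [NumberField K],
    Irreducible W.twoTorsionPolynomial.toPoly → Module.finrank ℚ K = 3 →
    (∃ θ : K, aeval θ W.twoTorsionPolynomial.toPoly = 0) → NumberField.discr K < 0 →
    (W.minimalDiscriminantNorm ℤ : ℝ) ≤ C * (W.conductorNorm ℤ : ℝ) ^ A

/-- **B1 (trivial):** the stub is the `A = 6 + ε` notch of the dial. -/
theorem B1_stub_iff_dial : Stub ↔ ∀ ε : ℝ, 0 < ε → IndexSzpiroExp (6 + ε) := Iff.rfl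

/-- **B2a (S; uses the LANDED support `resolventDiscBounds_proof`: `|d_K| ≤ 1944 N²`, and `N ≥ 1`):**
every notch of the dial is a polynomial-Szpiro statement on the class, two exponents up. -/
theorem B2a_polySzpiro_of_dial (A : ℝ) (hA : 0 ≤ A) (h : IndexSzpiroExp A) :
    PolySzpiroOnComplexClass (A + 2) := by
  sorry

/-- **B2b (trivial, `|d_K| ≥ 1`):** and conversely with the same exponent — so the dial has NO notch strictly
between "polynomial Szpiro with SOME exponent on the class" (the A-PS rung restricted to the class, OPEN;
Stewart–Yu's subexponential bound is off the dial) and the stub `A = 6 + ε`. -/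
theorem B2b_dial_of_polySzpiro (A : ℝ) (h : PolySzpiroOnComplexClass A) : IndexSzpiroExp A := by
  obtain ⟨C, hC⟩ := h
  refine ⟨max C 0, fun W _ K _ _ hirr h3 hθ hneg => ?_⟩
  have h1 := hC W K hirr h3 hθ hneg
  have hd : (1 : ℝ) ≤ |(NumberField.discr K : ℝ)| := by
    have := Int.one_le_abs (NumberField.discr_ne_zero K)
    rw [← Int.cast_abs]; exact_mod_cast this
  have hN : (0 : ℝ) ≤ (W.conductorNorm ℤ : ℝ) ^ A := Real.rpow_nonneg (Nat.cast_nonneg _) _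
  calc (W.minimalDiscriminantNorm ℤ : ℝ) ≤ C * (W.conductorNorm ℤ : ℝ) ^ A := h1
    _ ≤ max C 0 * (W.conductorNorm ℤ : ℝ) ^ A := by gcongr; exact le_max_left _ _
    _ = max C 0 * 1 * (W.conductorNorm ℤ : ℝ) ^ A := by rw [mul_one]
    _ ≤ max C 0 * |(NumberField.discr K : ℝ)| * (W.conductorNorm ℤ : ℝ) ^ A := by gcongr

/-- **B-fixed-field.** The NON-UNIFORM reshape: the constant may depend on the cubic field `K`
(the allowance `|d_K|` is then absorbed into `C`). -/
def StubFixedField : Prop :=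
  ∀ (K : Type) [Field K] [NumberField K], Module.finrank ℚ K = 3 → NumberField.discr K < 0 →
    ∀ ε : ℝ, 0 < ε → ∃ C : ℝ, ∀ (W : WeierstrassCurve ℚ) [W.IsElliptic],
      Irreducible W.twoTorsionPolynomial.toPoly → (∃ θ : K, aeval θ W.twoTorsionPolynomial.toPoly = 0) →
      (W.minimalDiscriminantNorm ℤ : ℝ) ≤ C * (W.conductorNorm ℤ : ℝ) ^ (6 + ε)

/-- **B3 (trivial quantifier shuffle):** uniform ⇒ fixed-field.  (The converse is the route's demanded
"uniformity-in-`K` mechanism"; and by k1-G3 `A6_radical_mersenne_ge_of_stub` already `StubFixedField` at the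
single field `ℚ(∛2)` forces `rad (2^m − 1) ≥ c(ε) · 2^{2m/(6+ε)}` — abc-hard currency — so dropping uniformity
buys nothing provable.) -/
theorem B3_fixedField_of_stub (h : Stub) : StubFixedField := by
  intro K _ _ h3 hneg ε hε
  obtain ⟨C, hC⟩ := h ε hε
  refine ⟨C * |(NumberField.discr K : ℝ)|, fun W _ hirr hθ => ?_⟩
  have := hC W K hirr h3 hθ hneg
  simpa [mul_assoc] using this

end Summit.ABC.ABC.Cruxes.IndexSzpiro.StubIdeas2G9
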